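import Summits.CriticalPhenomena.PercolationContinuityZ3.Theorems.SahiMasterFamilyOrShapeDomination
import Summits.CriticalPhenomena.PercolationContinuityZ3.Theorems.SahiMasterFamilyOrShapeCone

/-!
# The OR-shape at every order, V-b: the zero locus of the two corrections

Unit `prim-master-conj` (crux anchor stmt-CriticalPhenomena-4575, helper work), gen 17; memo
`run/shared/lean/prim/prim-l12/prim-master-conj/POINTWISE.md` §18.  Prepares the settled-class closure (`…OrShapeSettled`).

In the identity of Part III, `E(U) = M + t·ν_A·Z + R_c` with `Z = [x^univ] E_K` and `R_c = [x^univ] E_K·Σ_ω μ⁰(ω)1_{A⁰}(ω)Δ_ω`, this file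
determines WHEN the two corrections vanish at an interior parameter, in parameter-free terms:
* `le_coeff_univ_pow_r` / `coeff_univ_pow_r_pos` — for a configuration `ω` missing exactly the nonempty set `M(ω)` of the `B_j`,
  `[x^univ] r_ω^{|M(ω)|} ≥ |M(ω)|!·|M(ω)ᶜ|! > 0`;  `r_mul_r_eq_zero` — `r_ω² = 0` when `|M(ω)| ≤ 1` (so `Δ_ω = 0`);
* `coeff_univ_EK_eq_zero_iff` — at an interior parameter, `Z = 0 ↔ ∀ j, B_j = univ`;
* `rc_eq_zero_iff` — at an interior parameter, `R_c = 0 ↔` no configuration of `A⁰` (off `e`) misses two of the `B_j`.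
HONEST FRAMING: bookkeeping; nothing about `C_k` in general.  Axioms standard. [this work]
-/

set_option autoImplicit false

open Finset

open private SqFree.ext coeff_add coeff_sub coeff_one coeff_mul coeff_sum coeff_single coeff_C_mul coeff_C coeff_neg
  isNil_single isNil_lin IsNil.add IsNil.sub IsNil.mul_left IsNil.neg IsNil.sum
  binomB_zero_right C_mul_single single_mul_single_self single_mul_single_of_disjoint rch_one rch_zero rch_succ_real
  from Literature.Combinatorics.Sahi2008.CumulationCone

open private coeff_lin_pow from Literature.Combinatorics.Sahi2008.FKGCumulation

noncomputable section

open scoped Classical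

namespace Summit.CriticalPhenomena.PercolationContinuityZ3.Theorems

namespace OrShape

open Function
open Literature.Combinatorics.Sahi2008
open Literature.Combinatorics.Sahi2008.SqFree
open Literature.Probability.Percolation.DecisionTree (ind ind_of_mem ind_of_not_mem ind_nonneg)

/-! ### The zero locus of the two corrections -/

section ZeroLocus

variable {ι : Type} [Fintype ι] (p : ι → unitInterval) (e : ι) {n : ℕ} (A : Set (Set ι)) (B : Fin (n + 1) → Set (Set ι))

omit [Fintype ι] in
/-- `σ − X_ω = Σ_{j : ω ∉ B_j} x_j` is the linear form of the complement indicators. [this work] -/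
theorem sigma_sub_lin_eq (ω : Set ι) :
    (∑ j : Fin (n + 1), single ({j} : Finset (Fin (n + 1))) (1 : ℝ)) - lin (fun j => ind (B j)) ω =
      lin (fun j (ω' : Set ι) => 1 - ind (B j) ω') ω := by
  unfold SqFree.lin
  rw [← Finset.sum_sub_distrib]
  exact Finset.sum_congr rfl fun j _ => by rw [single_sub']

omit [Fintype ι] in
/-- **`[x^univ] r_ω^{|M(ω)|} ≥ |M(ω)|!·|M(ω)ᶜ|!`** for the set `M(ω)` of members missed by `ω`, if nonempty. [this work] -/
theorem le_coeff_univ_pow_r (ω : Set ι) (hM : 1 ≤ ((univ : Finset (Fin (n + 1))).filter (fun j => ω ∉ B j)).card) :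
    ((((univ : Finset (Fin (n + 1))).filter (fun j => ω ∉ B j)).card.factorial : ℝ) *
        (((univ : Finset (Fin (n + 1))).filter (fun j => ω ∈ B j)).card.factorial : ℝ)) ≤
      ((((∑ j : Fin (n + 1), single ({j} : Finset (Fin (n + 1))) (1 : ℝ)) - lin (fun j => ind (B j)) ω) *
        inv1 (lin (fun j => ind (B j)) ω)) ^ ((univ : Finset (Fin (n + 1))).filter (fun j => ω ∉ B j)).card).coeff univ := by
  set M := (univ : Finset (Fin (n + 1))).filter (fun j => ω ∉ B j) with hMdef
  set H := (univ : Finset (Fin (n + 1))).filter (fun j => ω ∈ B j) with hHdef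
  set D := lin (fun j (ω' : Set ι) => 1 - ind (B j) ω') ω with hD
  set X := lin (fun j => ind (B j)) ω with hX
  have hDnn : D.Nonneg := by
    rw [hD]; unfold SqFree.lin
    exact nonneg_sum fun j _ => nonneg_single _ (by
      show (0 : ℝ) ≤ 1 - ind (B j) ω
      unfold ind; split_ifs <;> norm_num)
  have hXnn : X.Nonneg := by
    rw [hX]; unfold SqFree.lin
    exact nonneg_sum fun j _ => nonneg_single _ (ind_nonneg _ _)
  rw [sigma_sub_lin_eq B ω, mul_pow]
  -- `D^k ≥ k!·x^M`
  have hDk : (D ^ M.card - single M ((M.card.factorial : ℝ))).Nonneg := by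
    have hc : (D ^ M.card).coeff M = (M.card.factorial : ℝ) := by
      rw [hD, coeff_lin_pow, if_pos rfl, Finset.prod_eq_one, mul_one]
      intro j hj
      rw [hMdef, Finset.mem_filter] at hj
      rw [ind_of_not_mem hj.2, sub_zero]
    have h := nonneg_sub_single_coeff (nonneg_pow hDnn M.card) M
    rwa [hc] at h
  -- `(inv1 X)^k ≥ X^{|H|} ≥ |H|!·x^H`
  have hHle : H.card ≤ Fintype.card (Fin (n + 1)) := Finset.card_le_univ H
  have hI : ((inv1 X) ^ M.card - single H ((H.card.factorial : ℝ))).Nonneg := by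
    have hc : (X ^ H.card).coeff H = (H.card.factorial : ℝ) := by
      rw [hX, coeff_lin_pow, if_pos rfl, Finset.prod_eq_one, mul_one]
      intro j hj
      rw [hHdef, Finset.mem_filter] at hj
      exact ind_of_mem hj.2
    have h1 := nonneg_sub_single_coeff (nonneg_pow hXnn H.card) H
    rw [hc] at h1
    exact nonneg_sub_trans h1 (nonneg_inv1_pow_sub_pow hXnn hM hHle)
  have hprod := nonneg_mul_sub_mul hDk hI (nonneg_single _ (Nat.cast_nonneg _)) (nonneg_pow (nonneg_inv1 hXnn) _)
  have hdisj : Disjoint M H := by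
    rw [hMdef, hHdef, Finset.disjoint_filter]; intro j _ h; exact fun h' => h h'
  have hunion : M ∪ H = univ := by
    ext j; simp only [hMdef, hHdef, Finset.mem_union, Finset.mem_filter, Finset.mem_univ, true_and, iff_true]; tauto
  rw [single_mul_single_of_disjoint hdisj, hunion] at hprod
  have h := coeff_le_of_nonneg_sub hprod univ
  rwa [coeff_single, if_pos rfl] at h

omit [Fintype ι] in
/-- `[x^univ] r_ω^{|M(ω)|} > 0` when `ω` misses some member. [this work] -/
theorem coeff_univ_pow_r_pos (ω : Set ι) (hM : 1 ≤ ((univ : Finset (Fin (n + 1))).filter (fun j => ω ∉ B j)).card) :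
    0 < ((((∑ j : Fin (n + 1), single ({j} : Finset (Fin (n + 1))) (1 : ℝ)) - lin (fun j => ind (B j)) ω) *
        inv1 (lin (fun j => ind (B j)) ω)) ^ ((univ : Finset (Fin (n + 1))).filter (fun j => ω ∉ B j)).card).coeff univ :=
  lt_of_lt_of_le (by positivity) (le_coeff_univ_pow_r B ω hM)

omit [Fintype ι] in
/-- `r_ω² = 0` when `ω` misses at most one member. [this work] -/
theorem r_mul_r_eq_zero (ω : Set ι) (hM : ((univ : Finset (Fin (n + 1))).filter (fun j => ω ∉ B j)).card ≤ 1) :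
    (((∑ j : Fin (n + 1), single ({j} : Finset (Fin (n + 1))) (1 : ℝ)) - lin (fun j => ind (B j)) ω) *
        inv1 (lin (fun j => ind (B j)) ω)) *
      ((((∑ j : Fin (n + 1), single ({j} : Finset (Fin (n + 1))) (1 : ℝ)) - lin (fun j => ind (B j)) ω) *
        inv1 (lin (fun j => ind (B j)) ω))) = 0 := by
  set M := (univ : Finset (Fin (n + 1))).filter (fun j => ω ∉ B j) with hMdef
  have hD : (∑ j : Fin (n + 1), single ({j} : Finset (Fin (n + 1))) (1 : ℝ)) - lin (fun j => ind (B j)) ω =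
      ∑ j ∈ M, single ({j} : Finset (Fin (n + 1))) (1 : ℝ) := by
    rw [sigma_sub_lin_eq B ω]
    unfold SqFree.lin
    rw [hMdef, Finset.sum_filter]
    refine Finset.sum_congr rfl fun j _ => ?_
    by_cases hj : ω ∈ B j
    · rw [if_neg (not_not.mpr hj)]
      simp only [ind_of_mem hj, sub_self]
      exact SqFree.ext fun τ => by rw [coeff_single]; split_ifs <;> rfl
    · rw [if_pos hj]
      simp only [ind_of_not_mem hj, sub_zero]
  have hDD : ((∑ j : Fin (n + 1), single ({j} : Finset (Fin (n + 1))) (1 : ℝ)) - lin (fun j => ind (B j)) ω) *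
      ((∑ j : Fin (n + 1), single ({j} : Finset (Fin (n + 1))) (1 : ℝ)) - lin (fun j => ind (B j)) ω) = 0 := by
    rw [hD]
    rcases Nat.le_one_iff_eq_zero_or_eq_one.mp hM with h0 | h1
    · rw [Finset.card_eq_zero.mp h0, Finset.sum_empty, mul_zero]
    · obtain ⟨j0, hj0⟩ := Finset.card_eq_one.mp h1
      rw [hj0, Finset.sum_singleton, single_mul_single_self (singleton_nonempty j0)]
  calc _ = (((∑ j : Fin (n + 1), single ({j} : Finset (Fin (n + 1))) (1 : ℝ)) - lin (fun j => ind (B j)) ω) *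
        ((∑ j : Fin (n + 1), single ({j} : Finset (Fin (n + 1))) (1 : ℝ)) - lin (fun j => ind (B j)) ω)) *
        (inv1 (lin (fun j => ind (B j)) ω) * inv1 (lin (fun j => ind (B j)) ω)) := by ring
    _ = 0 := by rw [hDD, zero_mul]

end ZeroLocus

/-! ### `Z = [x^univ] E_K` and `R_c`: when do they vanish? -/

section EK

variable {ι : Type} [Fintype ι] (p : ι → unitInterval) (e : ι) {n : ℕ} (A : Set (Set ι)) (B : Fin (n + 1) → Set (Set ι))

/-- `μ_{p[e↦0]}(ω) > 0` off `e` at an interior parameter. [folklore] -/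
theorem bernoulliWeight_update_zero_pos (hp : ∀ i, (p i : ℝ) ∈ Set.Ioo (0 : ℝ) 1) {ω : Set ι} (he : e ∉ ω) :
    0 < bernoulliWeight (update p e 0) ω := by
  rw [(bernoulliWeight_update p e 0 he).2]
  simpa using offWeight_pos hp e ω

/-- `E_K − 1 ∈ 𝒫` (for `s ≥ 0`). [cite: Sahi2008, proof of Lemma 16 (p. 224)] -/
theorem nonneg_EK_sub_one {s : ℝ} (hs : 0 ≤ s) :
    ((∏ ω, binomB (-(s * bernoulliWeight (update p e 0) ω))
      (((∑ j : Fin (n + 1), single ({j} : Finset (Fin (n + 1))) (1 : ℝ)) - lin (fun j => ind (B j)) ω) *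
        inv1 (lin (fun j => ind (B j)) ω))) - 1).Nonneg :=
  nonneg_prod_sub_one _
    (fun ω _ => Nonneg.binomB_of_nonpos (neg_nonpos.mpr (mul_nonneg hs
      (Literature.Probability.Percolation.BHK2006.weight_nonneg (fun i => (update p e 0 i).2.1) (fun i => (update p e 0 i).2.2) ω)))
      (nonneg_r B ω))
    (fun ω _ => nonneg_binomB_neg_sub_one (mul_nonneg hs
      (Literature.Probability.Percolation.BHK2006.weight_nonneg (fun i => (update p e 0 i).2.1) (fun i => (update p e 0 i).2.2) ω))
      (nonneg_r B ω))

/-- `E_K` dominates each of its factors. [this work] -/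
theorem nonneg_EK_sub_factor {s : ℝ} (hs : 0 ≤ s) (ω₀ : Set ι) :
    ((∏ ω, binomB (-(s * bernoulliWeight (update p e 0) ω))
      (((∑ j : Fin (n + 1), single ({j} : Finset (Fin (n + 1))) (1 : ℝ)) - lin (fun j => ind (B j)) ω) *
        inv1 (lin (fun j => ind (B j)) ω))) -
      binomB (-(s * bernoulliWeight (update p e 0) ω₀))
        (((∑ j : Fin (n + 1), single ({j} : Finset (Fin (n + 1))) (1 : ℝ)) - lin (fun j => ind (B j)) ω₀) *
          inv1 (lin (fun j => ind (B j)) ω₀))).Nonneg :=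
  nonneg_prod_sub_factor _
    (fun ω _ => Nonneg.binomB_of_nonpos (neg_nonpos.mpr (mul_nonneg hs
      (Literature.Probability.Percolation.BHK2006.weight_nonneg (fun i => (update p e 0 i).2.1) (fun i => (update p e 0 i).2.2) ω)))
      (nonneg_r B ω))
    (fun ω _ => nonneg_binomB_neg_sub_one (mul_nonneg hs
      (Literature.Probability.Percolation.BHK2006.weight_nonneg (fun i => (update p e 0 i).2.1) (fun i => (update p e 0 i).2.2) ω))
      (nonneg_r B ω)) (mem_univ ω₀)

omit [Fintype ι] in
/-- If every `B_j` is sure then every `r_ω` vanishes. [this work] -/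
theorem r_eq_zero_of_forall_univ (hBu : ∀ j, B j = Set.univ) (ω : Set ι) :
    ((∑ j : Fin (n + 1), single ({j} : Finset (Fin (n + 1))) (1 : ℝ)) - lin (fun j => ind (B j)) ω) *
      inv1 (lin (fun j => ind (B j)) ω) = 0 := by
  rw [sigma_sub_lin_eq B ω]
  have : lin (fun j (ω' : Set ι) => 1 - ind (B j) ω') ω = 0 := by
    unfold SqFree.lin
    refine Finset.sum_eq_zero fun j _ => ?_
    simp only [hBu j, ind_of_mem (Set.mem_univ ω), sub_self]
    exact SqFree.ext fun τ => by rw [coeff_single]; split_ifs <;> rfl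
  rw [this, zero_mul]

/-- **`Z = 0` iff every `B_j` is sure** (interior parameter, `B_j` `e`-free). [this work] -/
theorem coeff_univ_EK_eq_zero_iff (hp : ∀ i, (p i : ℝ) ∈ Set.Ioo (0 : ℝ) 1) (hB : ∀ j (b : Bool), secAt e b (B j) = B j) :
    (∏ ω, binomB (-((1 - (p e : ℝ)) * bernoulliWeight (update p e 0) ω))
      (((∑ j : Fin (n + 1), single ({j} : Finset (Fin (n + 1))) (1 : ℝ)) - lin (fun j => ind (B j)) ω) *
        inv1 (lin (fun j => ind (B j)) ω))).coeff univ = 0 ↔ ∀ j, B j = Set.univ := by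
  have hs : 0 < 1 - (p e : ℝ) := sub_pos.mpr (hp e).2
  constructor
  · intro hZ j₀
    by_contra hne
    obtain ⟨ω₁, hω₁⟩ : ∃ ω₁, ω₁ ∉ B j₀ := by
      by_contra h; push Not at h; exact hne (Set.eq_univ_of_forall h)
    set ω₀ : Set ι := ω₁ \ {e} with hω₀
    have he0 : e ∉ ω₀ := fun h => h.2 rfl
    have hω₀B : ω₀ ∉ B j₀ := by
      intro h
      apply hω₁
      rw [← hB j₀ false, mem_secAt]
      simpa [forceAt] using h
    set M := (univ : Finset (Fin (n + 1))).filter (fun j => ω₀ ∉ B j) with hM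
    have hMcard : 1 ≤ M.card := Finset.card_pos.mpr ⟨j₀, Finset.mem_filter.mpr ⟨mem_univ _, hω₀B⟩⟩
    have hMle : M.card ≤ Fintype.card (Fin (n + 1)) := Finset.card_le_univ M
    have hc : 0 < (1 - (p e : ℝ)) * bernoulliWeight (update p e 0) ω₀ := mul_pos hs (bernoulliWeight_update_zero_pos p e hp he0)
    -- `Z ≥ [x^univ] (one factor) ≥ (−1)^k C(−c,k)·[x^univ] r^k > 0`
    have h1 := coeff_le_of_nonneg_sub (nonneg_EK_sub_factor p e B (le_of_lt hs) ω₀) univ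
    have h2 := coeff_le_of_nonneg_sub (nonneg_binomB_neg_sub_term (le_of_lt hc) (nonneg_r B ω₀) hMle) univ
    rw [coeff_C_mul'] at h2
    have h3 := mul_pos (neg_one_pow_mul_rch_pos_of_neg hc M.card) (coeff_univ_pow_r_pos B ω₀ hMcard)
    linarith
  · intro hBu
    rw [Finset.prod_eq_one fun ω _ => by rw [r_eq_zero_of_forall_univ B hBu ω, binomB_zero_right], coeff_one,
      if_neg (Finset.univ_nonempty.ne_empty)]

/-- **`R_c = 0` iff no configuration of `A⁰` (off `e`) misses two of the `B_j`** (interior parameter). [this work] -/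
theorem rc_eq_zero_iff (hp : ∀ i, (p i : ℝ) ∈ Set.Ioo (0 : ℝ) 1) :
    ((∏ ω, binomB (-((1 - (p e : ℝ)) * bernoulliWeight (update p e 0) ω))
          (((∑ j : Fin (n + 1), single ({j} : Finset (Fin (n + 1))) (1 : ℝ)) - lin (fun j => ind (B j)) ω) *
            inv1 (lin (fun j => ind (B j)) ω))) *
        ∑ ω, C (bernoulliWeight (update p e 0) ω * ind (secAt e false A) ω) *
          (1 - C (1 - (p e : ℝ)) * ((((∑ j : Fin (n + 1), single ({j} : Finset (Fin (n + 1))) (1 : ℝ)) - lin (fun j => ind (B j)) ω) *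
            inv1 (lin (fun j => ind (B j)) ω))) -
            binomB (1 - (p e : ℝ)) ((((∑ j : Fin (n + 1), single ({j} : Finset (Fin (n + 1))) (1 : ℝ)) - lin (fun j => ind (B j)) ω) *
            inv1 (lin (fun j => ind (B j)) ω))))).coeff univ = 0 ↔
      ∀ ω : Set ι, e ∉ ω → ω ∈ secAt e false A → ((univ : Finset (Fin (n + 1))).filter (fun j => ω ∉ B j)).card ≤ 1 := by
  have hs0 : 0 < 1 - (p e : ℝ) := sub_pos.mpr (hp e).2
  have hs1 : 1 - (p e : ℝ) < 1 := sub_lt_self 1 (hp e).1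
  set EK := (∏ ω, binomB (-((1 - (p e : ℝ)) * bernoulliWeight (update p e 0) ω))
    (((∑ j : Fin (n + 1), single ({j} : Finset (Fin (n + 1))) (1 : ℝ)) - lin (fun j => ind (B j)) ω) *
      inv1 (lin (fun j => ind (B j)) ω))) with hEK
  set S := ∑ ω, C (bernoulliWeight (update p e 0) ω * ind (secAt e false A) ω) *
    (1 - C (1 - (p e : ℝ)) * ((((∑ j : Fin (n + 1), single ({j} : Finset (Fin (n + 1))) (1 : ℝ)) - lin (fun j => ind (B j)) ω) *
      inv1 (lin (fun j => ind (B j)) ω))) -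
      binomB (1 - (p e : ℝ)) ((((∑ j : Fin (n + 1), single ({j} : Finset (Fin (n + 1))) (1 : ℝ)) - lin (fun j => ind (B j)) ω) *
      inv1 (lin (fun j => ind (B j)) ω)))) with hS
  have hterm : ∀ ω ∈ (univ : Finset (Set ι)), (C (bernoulliWeight (update p e 0) ω * ind (secAt e false A) ω) *
      (1 - C (1 - (p e : ℝ)) * ((((∑ j : Fin (n + 1), single ({j} : Finset (Fin (n + 1))) (1 : ℝ)) - lin (fun j => ind (B j)) ω) *
        inv1 (lin (fun j => ind (B j)) ω))) -
        binomB (1 - (p e : ℝ)) ((((∑ j : Fin (n + 1), single ({j} : Finset (Fin (n + 1))) (1 : ℝ)) - lin (fun j => ind (B j)) ω) *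
        inv1 (lin (fun j => ind (B j)) ω))))).Nonneg := fun ω _ =>
    nonneg_mul (nonneg_C (mul_nonneg (Literature.Probability.Percolation.BHK2006.weight_nonneg (fun i => (update p e 0 i).2.1)
      (fun i => (update p e 0 i).2.2) ω) (ind_nonneg _ _)))
      (nonneg_one_sub_smul_sub_binomB (le_of_lt hs0) (le_of_lt hs1) (isNil_r B ω) (nonneg_r B ω))
  have hSnn : S.Nonneg := nonneg_sum hterm
  constructor
  · intro hR ω₀ he0 hA0
    by_contra hk
    push Not at hk
    set M := (univ : Finset (Fin (n + 1))).filter (fun j => ω₀ ∉ B j) with hM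
    have hMle : M.card ≤ Fintype.card (Fin (n + 1)) := Finset.card_le_univ M
    have hc : 0 < bernoulliWeight (update p e 0) ω₀ * ind (secAt e false A) ω₀ := by
      rw [ind_of_mem hA0, mul_one]; exact bernoulliWeight_update_zero_pos p e hp he0
    -- `R_c ≥ [x^univ] S ≥ c·[x^univ] Δ_{ω₀} ≥ c·(−1)^{k+1}C(s,k)·[x^univ] r^k > 0`
    have h1 : S.coeff univ ≤ (EK * S).coeff univ := by
      refine coeff_le_of_nonneg_sub ?_ univ
      have e1 : EK * S - S = (EK - 1) * S := by ring
      rw [e1]; exact nonneg_mul (nonneg_EK_sub_one p e B (le_of_lt hs0)) hSnn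
    have h2 := coeff_le_of_nonneg_sub (nonneg_sum_sub_term hterm (mem_univ ω₀)) univ
    rw [coeff_C_mul'] at h2
    have h3 := coeff_le_of_nonneg_sub (nonneg_delta_sub_term (le_of_lt hs0) (le_of_lt hs1) (nonneg_r B ω₀) hk hMle) univ
    rw [coeff_C_mul'] at h3
    have h4 : 0 < (-1 : ℝ) ^ (M.card + 1) * rch M.card (1 - (p e : ℝ)) := by
      have h := psi_pos hs0 hs1 (k := M.card) (by omega)
      have hf : (0 : ℝ) < (M.card.factorial : ℝ) := by positivity
      by_contra hneg
      push Not at hneg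
      nlinarith [mul_nonneg (neg_nonneg.mpr hneg) hf.le]
    have h5 := mul_pos h4 (coeff_univ_pow_r_pos B ω₀ (by rw [← hM]; omega))
    have h6 := mul_pos hc h5
    nlinarith
  · intro hcond
    have hS0 : S = 0 := by
      rw [hS]
      refine Finset.sum_eq_zero fun ω _ => ?_
      by_cases he : e ∈ ω
      · rw [bernoulliWeight_update_zero_eq_zero p e he, zero_mul, map_zero, zero_mul]
      · by_cases hA0 : ω ∈ secAt e false A
        · rw [delta_eq_zero_of_sq _ (isNil_r B ω) (r_mul_r_eq_zero B ω (hcond ω he hA0)), mul_zero]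
        · rw [ind_of_not_mem hA0, mul_zero, map_zero, zero_mul]
    rw [hS0, mul_zero]
    rfl

end EK


end OrShape
end Summit.CriticalPhenomena.PercolationContinuityZ3.Theorems
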